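import Summits.KontsevichZagierPeriods.KontsevichZagierPeriods.Theorems.LinRedNormalFormArrangementNormalFormStubRebaseSimpleZeroNestedDiffE1Mirror
import Summits.KontsevichZagierPeriods.KontsevichZagierPeriods.Theorems.LinRedNormalFormArrangementNormalFormStubRebaseSimpleZeroNestedDiffParAll

/-!
# Stub `stub_rebaseSimpleZeroTwo`, part `rebaseSimpleZero_HDiff1_of_HPar1` (crux
`ArrangementNormalForm`, line `janus-bands`) — assembly `NestedDiffE1HVert`

**The interval normal form `HDiff₁` from the residual VERTEX hypothesis.** With `HPar1` landed
(`RebaseE2.hparS`, worker W14), the box-Janus reduction of the previous bricks (grid of thick cells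
`IsDN.good_middle`, isolation of the singular ends `IsDN.good_of_ends`, far pinches
`IsDN.good_pinch_far`, pole ends `IsDN.pinch_of_pole`, base reflection `IsDN.good_of_mirror`) closes
every datum of `HDiff₁` (`RebaseE1.IsDN`) GIVEN the residual hypothesis `RebaseE1.HVertLS` at the
left end for the datum and for its base reflection: a pinch `A(l) = B(l) = t₀` whose vertex carries
the base pole (`r = l`) or a letter (`cᵢ = t₀` or `cⱼ(l) = t₀`), the right end being regular
(`RebaseE1.IsDN.good_of_HVert`, registered as `rebaseSimpleZero_E1ofHVert`). Literal forms:
`rebaseSimpleZero_HDiff1_of_HVert` (binders of the hypothesis `HDiff₁` of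
`rebaseSimpleZeroTwo_of_intervalGGset`) and the stub-format closure `rebaseSimpleZeroTwo_of_HVert`
(`GS 0 2 → closure (GG 0 2 2)` under the literal vertex hypothesis `HVert`).

References: M. Kontsevich, D. Zagier, *Periods* (2001), §1.2, rules (1a), (1b), (2).
-/

noncomputable section

open Set MeasureTheory MvPolynomial
open Literature.NumberTheory.Transcendental Literature.ModelTheory.ExponentialFields

namespace Summit.KontsevichZagierPeriods.ArrangementNormalForm.JanusBands

namespace RebaseE1

open SeparatePos RebasePos RebaseZero RebaseNest RebaseDiff

variable {i j : Fin 2} {s : KZ.IntegralRep (0 + 1 + 2)} {l u : ℚ} {A B : Cf} {T : BData}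
  {p : MvPolynomial (Fin 0) ℚ} {a : Fin 2 → Option Cf} {ci cj : Cf}

/-- **`HDiff₁` from the residual vertex hypothesis.** A datum of `HDiff₁` is good for `GG 0 2 2`
as soon as `HVertLS` holds for its letter data and for the reflected letter data: `HPar1` is
`RebaseE2.hparS`; vanishing base constant ⇒ relation; isolate the singular ends
(`IsDN.good_of_ends`); the left end is `IsDN.good_left_of_HVertL`; the right end is the left
end of the base reflection (`IsDN.good_of_mirror`). [Kontsevich–Zagier 2001, §1.2] -/
theorem IsDN.good_of_HVert (h : IsDN s l u A B T p a i j) (hL : LData T a i j ci cj)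
    (hVl : HVertLS T p a i j ci cj)
    (hVr : HVertLS (mirT T) (MvPolynomial.C (-1) * p) (mirA a) i j (negS ci) (negS cj)) :
    Good 2 (KZ.of s) := by
  have hP : HParS T p a i j ci cj := RebaseE2.hparS hL
  have hP' : HParS (mirT T) (MvPolynomial.C (-1) * p) (mirA a) i j (negS ci) (negS cj) :=
    RebaseE2.hparS hL.mirror
  by_cases hK : Kc T p = 0
  · exact h.good_zero hK
  have hlu := h.lu
  have hm1 : l < l + (u - l) / 3 := by linarith
  have hm1' : l + (u - l) / 3 < u := by linarith
  have hm2 : l < u - (u - l) / 3 := by linarith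
  have hm2' : u - (u - l) / 3 < u := by linarith
  refine h.good_of_ends hL hP hK (fun hsing s₁ h₁ => ?_) fun hsing s₂ h₂ => ?_
  · exact h₁.good_left_of_HVertL hL hP hVl hsing (h.evq_lt hm1 hm1')
      (h.pole.imp_right fun hp => lt_of_lt_of_le hm1' hp)
  · refine h₂.good_of_mirror hL fun s' h' => h'.good_left_of_HVertL hL.mirror hP' hVr ?_ ?_ ?_
    · exact hsing.imp pinch_mirror.2 fun hp => by rw [mirT_ℓ₂, hp]
    · exact (lt_mirror _).2 (h.evq_lt hm2 hm2')
    · rw [mirT_ℓ₂]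
      rcases h.pole with hp | hp
      · exact Or.inr (by linarith)
      · exact Or.inl (by linarith)

end RebaseE1

/-- **Registered assembly `rebaseSimpleZero_E1ofHVert`** (part `rebaseSimpleZero_HDiff1_of_HPar1` of
`stub_rebaseSimpleZeroTwo`, line `janus-bands`): a datum of the interval normal form `HDiff₁`
(`RebaseE1.IsDN`, letter data `RebaseE1.LData`) is congruent modulo `KZ.relations` to the subgroup
generated by `GG 0 2 2` as soon as the residual vertex hypothesis `RebaseE1.HVertLS` holds for its
letter data and for the base-reflected letter data (`RebaseE1.IsDN.good_of_HVert`: `HPar1` by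
`RebaseE2.hparS`, grid of thick cells, isolation of the singular ends, far pinches, pole ends,
base reflection). [Kontsevich–Zagier 2001, §1.2, rules (1a), (1b), (2)] -/
theorem rebaseSimpleZero_E1ofHVert (i j : Fin 2) (s : KZ.IntegralRep (0 + 1 + 2)) (l u : ℚ) (A B ci cj : (Fin (0 + 1) → ℚ) × ℚ) (T : RebaseZero.BData) (p : MvPolynomial (Fin 0) ℚ) (a : Fin 2 → Option ((Fin (0 + 1) → ℚ) × ℚ)) (h : RebaseE1.IsDN s l u A B T p a i j) (hL : RebaseE1.LData T a i j ci cj) (hVl : RebaseE1.HVertLS T p a i j ci cj) (hVr : RebaseE1.HVertLS (RebaseE1.mirT T) (MvPolynomial.C (-1) * p) (RebaseE1.mirA a) i j (RebaseE1.negS ci) (RebaseE1.negS cj)) : RebaseZero.Good 2 (KZ.of s) :=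
  h.good_of_HVert hL hVl hVr

open RebaseZero RebaseNest in
/-- **`HDiff₁` from the residual vertex hypothesis `HVert`** (literal binders of the hypothesis
`HDiff₁` of `rebaseSimpleZeroTwo_of_intervalGGset`). The interval normal form `HDiff₁` of the
two-fibre rebase — every clean nest `A(y) < tᵢ < tⱼ < B(y)` over a literal rational interval
`{l < y < u}` with constant inner letter, outer letter of non-zero `y`-slope and base pole outside
the open interval is congruent modulo `KZ.relations` to the subgroup generated by `GG 0 2 2` —
follows from its residual sub-case `HVert`: non-zero base constant, a PINCH at the left end
(`A(l) = B(l) = t₀`) whose vertex carries the base pole (`ℓ₂.2 = l`) or a letter (`cᵢ = t₀` or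
`cⱼ(l) = t₀`), regular right end (`A(u) < B(u)`, pole off `(l, u]`).
[Kontsevich–Zagier 2001, §1.2, rules (1a), (1b), (2)] -/
theorem rebaseSimpleZero_HDiff1_of_HVert (HVert : ∀ (m : ℕ) (s : KZ.IntegralRep (0 + 1 + 2)) (L : Fin m → (Fin 0 → ℚ) × ℚ) (e : Fin m → ℕ) (p : MvPolynomial (Fin 0) ℚ) (ℓ₁ ℓ₂ : (Fin 0 → ℚ) × ℚ) (a : Fin 2 → Option ((Fin (0 + 1) → ℚ) × ℚ)) (lo hi : Fin 2 → Fin 2 ⊕ ((Fin (0 + 1) → ℚ) × ℚ)) (i j : Fin 2) (A B ci cj : (Fin (0 + 1) → ℚ) × ℚ) (l u : ℚ), i ≠ j → lo i = Sum.inr A → hi i = Sum.inl j → lo j = Sum.inl i → hi j = Sum.inr B → a i = some ci → a j = some cj → ci.1 (Fin.last 0) = 0 → cj.1 (Fin.last 0) ≠ 0 → ((MvPolynomial.coeff 0 p : ℚ) : ℝ) / ∏ k, ((L k).2 : ℝ) ^ e k ≠ 0 → A.1 (Fin.last 0) * l + A.2 = B.1 (Fin.last 0) * l + B.2 → (ℓ₂.2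 = l ∨ ci.2 = A.1 (Fin.last 0) * l + A.2 ∨ cj.1 (Fin.last 0) * l + cj.2 = A.1 (Fin.last 0) * l + A.2) → A.1 (Fin.last 0) * u + A.2 < B.1 (Fin.last 0) * u + B.2 → (ℓ₂.2 ≤ l ∨ u < ℓ₂.2) → l < u → (∀ y : ℝ, (l : ℝ) < y → y < (u : ℝ) → RebaseZero.ev A y < RebaseZero.ev B y) → Bornology.IsBounded s.domain → s.domain = SeparatePos.gDom 0 2 2 ![RebaseZero.mk 1 (-l), RebaseZero.mk (-1) u] lo hi → EqOn s.integrand (RebasePos.glit 0 2 p L e ℓ₁ ℓ₂ 0 1 a) s.domain → ∃ c ∈ AddSubgroup.closure (SeparatePos.GGset 0 2 2), KZ.of s - c ∈ KZ.relations) (m : ℕ) (s : KZ.IntegralRep (0 + 1 + 2)) (L : Fin m → (Fin 0 → ℚ) × ℚ) (e : Fin m → ℕ) (p : MvPolynomial (Fin 0) ℚ) (ℓ₁ ℓ₂ : (Fin 0 → ℚ) × ℚ) (a : Fin 2 → Option ((Fin (0 + 1) → ℚ) × ℚ)) (lo hi : Fin 2 → Fin 2 ⊕ ((Fin (0 + 1)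 → ℚ) × ℚ)) (i j : Fin 2) (A B ci cj : (Fin (0 + 1) → ℚ) × ℚ) (l u : ℚ) (hij : i ≠ j) (hloi : lo i = Sum.inr A) (hhii : hi i = Sum.inl j) (hloj : lo j = Sum.inl i) (hhij : hi j = Sum.inr B) (hai : a i = some ci) (haj : a j = some cj) (hci : ci.1 (Fin.last 0) = 0) (hcj : cj.1 (Fin.last 0) ≠ 0) (hlu : l < u) (hAB : ∀ y : ℝ, (l : ℝ) < y → y < (u : ℝ) → RebaseZero.ev A y < RebaseZero.ev B y) (hpole : ℓ₂.2 ≤ l ∨ u ≤ ℓ₂.2) (hbd : Bornology.IsBounded s.domain) (hdom : s.domain = SeparatePos.gDom 0 2 2 ![RebaseZero.mk 1 (-l), RebaseZero.mk (-1) u] lo hi) (hint : EqOn s.integrand (RebasePos.glit 0 2 p L e ℓ₁ ℓ₂ 0 1 a) s.domain) : ∃ c ∈ AddSubgroup.closure (SeparatePos.GGset 0 2 2), KZ.of s - c ∈ KZ.relations := by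
  set T : BData := ⟨m, L, e, ℓ₁, ℓ₂, 0, 1⟩ with hT
  have hglit : RebasePos.glit 0 2 p L e ℓ₁ ℓ₂ 0 1 a = glitB T p a := rfl
  obtain ⟨hlo, hhi⟩ := eq_nlo_nhi hij hloi hhii hloj hhij
  subst hlo hhi
  have hL : RebaseE1.LData T a i j ci cj := ⟨hij, hai, haj, hci, hcj, rfl, rfl⟩
  have hN : RebaseE1.IsDN s l u A B T p a i j := ⟨hij, hdom, hglit ▸ hint, hbd, hlu, hAB, hpole⟩
  have hLm := hL.mirror
  have hVl : RebaseE1.HVertLS T p a i j ci cj := fun s' l' u' A' B' h' hK hpin hv hreg hr =>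
    HVert m s' L e p ℓ₁ ℓ₂ a (nlo i A') (nhi j B') i j A' B' ci cj l' u' hij (nlo_self i A') (nhi_of_ne hij B')
      (nlo_of_ne hij A') (nhi_self j B') hai haj hci hcj hK hpin hv hreg hr h'.lu h'.AB h'.bdd h'.dom h'.int
  have hVr : RebaseE1.HVertLS (RebaseE1.mirT T) (MvPolynomial.C (-1) * p) (RebaseE1.mirA a) i j
      (RebaseE1.negS ci) (RebaseE1.negS cj) := fun s' l' u' A' B' h' hK hpin hv hreg hr =>
    HVert m s' L e (MvPolynomial.C (-1) * p) ℓ₁ (ℓ₂.1, -ℓ₂.2) (RebaseE1.mirA a) (nlo i A') (nhi j B') i j A' B'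
      (RebaseE1.negS ci) (RebaseE1.negS cj) l' u' hij (nlo_self i A') (nhi_of_ne hij B') (nlo_of_ne hij A')
      (nhi_self j B') hLm.hi hLm.hj hLm.ci0 hLm.cj0 hK hpin hv hreg hr h'.lu h'.AB h'.bdd h'.dom h'.int
  exact hN.good_of_HVert hL hVl hVr

/-- **The stub under the residual vertex hypothesis** (`stub_rebaseSimpleZeroTwo`, line
`janus-bands`, skeleton v11 NARROW format): the rebase of the literal class `GS 0 2` (one base
coordinate with a simple pole, two fibres) into the subgroup generated by the rebased class
`GG 0 2 2` modulo `KZ.relations`, GIVEN the literal residual vertex hypothesis `HVert` of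
`rebaseSimpleZero_HDiff1_of_HVert` (pinch vertices carrying the base pole or a letter):
`rebaseSimpleZeroTwo_of_intervalGGset` (worker W13's normalisation to the interval normal form
`HDiff₁`) fed with `rebaseSimpleZero_HDiff1_of_HVert`. [Kontsevich–Zagier 2001, §1.2] -/
theorem rebaseSimpleZeroTwo_of_HVert (GS : ℕ → ℕ → Set KZ.FormalRep) (GG : ℕ → ℕ → ℕ → Set KZ.FormalRep) (hGS : ∀ b k, GS b k = {w : KZ.FormalRep | ∃ (m m' n₁ n₂ : ℕ) (s : KZ.IntegralRep (b + 1 + k)) (M : Fin m' → (Fin (b + 1) → ℚ) × ℚ) (L : Fin m → (Fin b → ℚ) × ℚ) (e : Fin m → ℕ) (p : MvPolynomial (Fin b) ℚ) (ℓ₁ ℓ₂ : (Fin b → ℚ) × ℚ) (a : Fin k → Option ((Fin (b + 1) → ℚ) × ℚ)) (lo hi : Fin k → Fin k ⊕ ((Fin (b + 1) → ℚ) × ℚ)), (n₁ = 0 ∨ n₂ = 0) ∧ n₂ = 1 ∧ Bornology.IsBounded s.domain ∧ s.domain = {z | (∀ j, 0 < ∑ i, ((M j).1 i : ℝ) * z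 (Fin.castAdd k i) + ((M j).2 : ℝ)) ∧ ∀ i, Sum.elim (fun j => z (Fin.natAdd (b + 1) j)) (fun c => ∑ i', (c.1 i' : ℝ) * z (Fin.castAdd k i') + (c.2 : ℝ)) (lo i) < z (Fin.natAdd (b + 1) i) ∧ z (Fin.natAdd (b + 1) i) < Sum.elim (fun j => z (Fin.natAdd (b + 1) j)) (fun c => ∑ i', (c.1 i' : ℝ) * z (Fin.castAdd k i') + (c.2 : ℝ)) (hi i)} ∧ EqOn s.integrand (fun z => MvPolynomial.aeval (fun i => z (Fin.castAdd k (Fin.castSucc i))) p / (∏ j, (∑ i, ((L j).1 i : ℝ) * z (Fin.castAdd k (Fin.castSucc i)) + ((L j).2 : ℝ)) ^ e j) * ((z (Fin.castAdd k (Fin.last b)) - (∑ i, (ℓ₁.1 i : ℝ) * z (Fin.castAdd k (Fin.castSucc i)) + (ℓ₁.2 : ℝ))) ^ n₁ / (z (Fin.castAdd k (Fin.last b)) - (∑ i, (ℓ₂.1 i : ℝ) * z (Fin.castAdd k (Fin.castSucc i)) + (ℓ₂.2 : ℝ))) ^ n₂) * ∏ i, (a i).elim 1 (fun c => 1 / (z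 (Fin.natAdd (b + 1) i) - (∑ i', (c.1 i' : ℝ) * z (Fin.castAdd k i') + (c.2 : ℝ))))) s.domain ∧ w = KZ.of s}) (hGG : ∀ b σ k, GG b σ k = {w : KZ.FormalRep | ∃ (m m' n₁ n₂ : ℕ) (s : KZ.IntegralRep (b + 1 + k)) (M : Fin m' → (Fin (b + 1) → ℚ) × ℚ) (L : Fin m → (Fin b → ℚ) × ℚ) (e : Fin m → ℕ) (p : MvPolynomial (Fin b) ℚ) (ℓ₁ ℓ₂ : (Fin b → ℚ) × ℚ) (a : Fin k → Option ((Fin (b + 1) → ℚ) × ℚ)) (lo hi : Fin k → Fin k ⊕ ((Fin (b + 1) → ℚ) × ℚ)), (n₁ = 0 ∨ n₂ = 0) ∧ (σ = 2 → (∀ i c, a i = some c → c.1 (Fin.last b) = 0) ∧ (∀ i c, (lo i = Sum.inr c ∨ hi i = Sum.inr c) → (c.1 (Fin.last b) = 0 ∨ c = (Pi.single (Fin.last b) 1, 0)))) ∧ Bornology.IsBounded s.domain ∧ s.domain = {z | (∀ j, 0 < ∑ i, ((M j).1 i : ℝ) * z (Fin.castAdd k i) + ((M j).2 : ℝ)) ∧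 ∀ i, Sum.elim (fun j => z (Fin.natAdd (b + 1) j)) (fun c => ∑ i', (c.1 i' : ℝ) * z (Fin.castAdd k i') + (c.2 : ℝ)) (lo i) < z (Fin.natAdd (b + 1) i) ∧ z (Fin.natAdd (b + 1) i) < Sum.elim (fun j => z (Fin.natAdd (b + 1) j)) (fun c => ∑ i', (c.1 i' : ℝ) * z (Fin.castAdd k i') + (c.2 : ℝ)) (hi i)} ∧ EqOn s.integrand (fun z => MvPolynomial.aeval (fun i => z (Fin.castAdd k (Fin.castSucc i))) p / (∏ j, (∑ i, ((L j).1 i : ℝ) * z (Fin.castAdd k (Fin.castSucc i)) + ((L j).2 : ℝ)) ^ e j) * ((z (Fin.castAdd k (Fin.last b)) - (∑ i, (ℓ₁.1 i : ℝ) * z (Fin.castAdd k (Fin.castSucc i)) + (ℓ₁.2 : ℝ))) ^ n₁ / (z (Fin.castAdd k (Fin.last b)) - (∑ i, (ℓ₂.1 i : ℝ) * z (Fin.castAdd k (Fin.castSucc i)) + (ℓ₂.2 : ℝ))) ^ n₂) * ∏ i, (a i).elim 1 (fun c => 1 / (z (Fin.natAdd (b + 1) i) - (∑ i', (c.1 i'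 : ℝ) * z (Fin.castAdd k i') + (c.2 : ℝ))))) s.domain ∧ w = KZ.of s}) (HVert : ∀ (m : ℕ) (s : KZ.IntegralRep (0 + 1 + 2)) (L : Fin m → (Fin 0 → ℚ) × ℚ) (e : Fin m → ℕ) (p : MvPolynomial (Fin 0) ℚ) (ℓ₁ ℓ₂ : (Fin 0 → ℚ) × ℚ) (a : Fin 2 → Option ((Fin (0 + 1) → ℚ) × ℚ)) (lo hi : Fin 2 → Fin 2 ⊕ ((Fin (0 + 1) → ℚ) × ℚ)) (i j : Fin 2) (A B ci cj : (Fin (0 + 1) → ℚ) × ℚ) (l u : ℚ), i ≠ j → lo i = Sum.inr A → hi i = Sum.inl j → lo j = Sum.inl i → hi j = Sum.inr B → a i = some ci → a j = some cj → ci.1 (Fin.last 0) = 0 → cj.1 (Fin.last 0) ≠ 0 → ((MvPolynomial.coeff 0 p : ℚ) : ℝ) / ∏ k, ((L k).2 : ℝ) ^ e k ≠ 0 → A.1 (Fin.last 0) * l + A.2 = B.1 (Fin.last 0) * l + B.2 → (ℓ₂.2 = l ∨ ci.2 = A.1 (Fin.last 0) * l + A.2 ∨ cj.1 (Fin.last 0)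 * l + cj.2 = A.1 (Fin.last 0) * l + A.2) → A.1 (Fin.last 0) * u + A.2 < B.1 (Fin.last 0) * u + B.2 → (ℓ₂.2 ≤ l ∨ u < ℓ₂.2) → l < u → (∀ y : ℝ, (l : ℝ) < y → y < (u : ℝ) → RebaseZero.ev A y < RebaseZero.ev B y) → Bornology.IsBounded s.domain → s.domain = SeparatePos.gDom 0 2 2 ![RebaseZero.mk 1 (-l), RebaseZero.mk (-1) u] lo hi → EqOn s.integrand (RebasePos.glit 0 2 p L e ℓ₁ ℓ₂ 0 1 a) s.domain → ∃ c ∈ AddSubgroup.closure (SeparatePos.GGset 0 2 2), KZ.of s - c ∈ KZ.relations) : ∀ x ∈ GS 0 2, ∃ c ∈ AddSubgroup.closure (GG 0 2 2), x - c ∈ KZ.relations := by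
  intro x hx
  rw [hGS] at hx
  obtain ⟨m, m', n₁, n₂, s, M, L, e, p, ℓ₁, ℓ₂, a, lo, hi, h12, hn, hbd, hdom, hint, rfl⟩ := hx
  rw [hGG]
  exact rebaseSimpleZeroTwo_of_intervalGGset (rebaseSimpleZero_HDiff1_of_HVert HVert) m m' n₁ n₂ s M L e p ℓ₁ ℓ₂
    a lo hi h12 hn hbd hdom hint

end Summit.KontsevichZagierPeriods.ArrangementNormalForm.JanusBands
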